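import Summits.BirchSwinnertonDyer.BirchSwinnertonDyer.Theorems.ClassRecordThreeEulerHalvesAtThreeJetchevMax
import Summits.BirchSwinnertonDyer.BirchSwinnertonDyer.Theorems.ClassRecordThreeEulerHalvesAtThreeWalkSupplyAtThreeDisplayPrint
import Summits.BirchSwinnertonDyer.BirchSwinnertonDyer.Theorems.ClassRecordThreeEulerHalvesAtThreeTwistLowerOfX11a

/-!
# BC3 BIRTH skeleton v8 for crux `EulerHalvesAtThree` (item stmt-BirchSwinnertonDyer-19109; routes `ClassRecordThree` r5 and
# `KolyvaginRoadThree`), line `Lines/birth.lean` — seat `bsd-stepL-tam3-p1` g8, 2026-08-27, on the REGISTERED v7 (planner g34,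
# 33afe5a715435a89): RULING 28's acceptance test (the STUB-FALSE-AS-TYPED receptacle schema of `stub_localFactsAtThree` conjunct 2
# ↦ the Literature FACT `Gross1991_heegnerPoint_sub_ratTorsion_mem_E0` BY NAME) + the three theorem-binders of `stub_factsAtThree`
# struck; RULING 22 (B) KEPT (`stub_x11aLowerHalfAtThree` registered, TL₃ DERIVED); every OPEN stub v7 VERBATIM

The DERIVED stub `stub_jetchevMaxHLAtThree` (Jetchev 2008 Thm. 1.4 in MAX form at `3 ∥ N`; registered signature unchanged) is
now `Koly.jetchevMaxHLAtThree_of_facts_of_print` (p547155; this seat's kernel §6 walk with every completion-layer input a tree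
theorem; NO core-vertex binder, NO kernel gap, NO supply hypothesis, NO receptacle schema) applied to the two CITABLE stubs:
* `stub_localFactsAtThree` (CITABLE — two cite-only Literature FACTS) — hPT (`poitouTate_selmerStructure_duality_conj`, ∀ number
  field) ∧ hF1 (`Gross1991_heegnerPoint_sub_ratTorsion_mem_E0`: Gross 1991 §6 ∕ [GZ86 III (3.1)], «y_n − RATIONAL TORSION ∈ E⁰» at
  square-free Kolyvagin conductors — the TRUE print; the supplier in frame is bsd-jet's `JET.forall_hGZ_of_Gross1991`, p540775,
  through p544982 ∕ p545834). v7's conjunct 2 (the unguarded receptacle schema, STUB-FALSE-AS-TYPED: mult-p3 g2's witness 11a1 ∕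
  ℚ(√−7) ∕ p = 5 ∕ m = 1, RULING 28) is GONE.
* `stub_factsAtThree` (CITABLE, by Literature decl name) — h52 (McCallum Prop. 5.2) · h44 (McCallum Prop. 4.4) · hGZ (Gross–Zagier)
  · hmod (modularity) · hMcU (McCallum Cor. 5.6). v7's hD36 ∕ hrec (Literature THEOREMS `phi_heegnerTau_mem_singularModuliField_holds` ∕
  `heegnerPointOfConductor_one_galoisConj_holds`) and h53 (Gross Prop. 5.3 = bsd-jet's THEOREM
  `JET.exists_mem_ringClassGal_isOfFinAddOrder_conj_sub_smul` at admissible conductors) are struck — discharged inside p547155.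
* `stub_jetchevMaxHLAtThree` — DERIVED (no `sorry` of its own), modulo SIX named Literature facts in all.
* `stub_jetchevDivisibilityRamHLMultiAtThree` ∕ `stub_jetchevDivisibilityNotRamHLMultiAtThree` (OPEN, IMC-grade: J₃ on MULTI-carrier
  frames) and `stub_x11aLowerHalfAtThree` (OPEN, item 19064 read at `p = 3`; TL₃ = `twistLowerAtThree_of_x11aLowerHalf`, DERIVED —
  RULING 22 (B)) — v7 VERBATIM. These three are the ONLY open stubs of the line (open mathematics: Jetchev's Conj. 1.3 on
  multi-carrier curves — the rank-one-localisation obstruction of every Kolyvagin-system method, MEMO-J3-v7 §4(a); the rank-0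
  `3`-part lower bound at a multiplicative `3` without (ram), §4(b)).
Composition `EulerHalvesAtThree_of`: the route decl BY NAME from `PublishedInputsThree` (item 19112, by name) and the stubs, through
`classRecordThree_eulerHalvesAtThree_of_jetchevMaxHL_of_multi_of_twistLower` (`…JetchevMax.lean` §3, p438720), `hrec`/`hD36` fed by the
Literature theorems; the `KolyvaginRoadThree` twin alongside. Sorries ONLY in the five `sorry`-stubs (two citable, three open).
Nothing is asserted about any curve (T7). The HYBRID variant (RULING 25 (a): J₃-multi ×2 ↦ ONE CoS₃-multi stub) is delivered
alongside as `birth-v8h.lean` — the owner's RECOMMENDED registration (MEMO-J3-v7 §4(c)).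
-/

set_option linter.dupNamespace false
set_option autoImplicit false

noncomputable section

open scoped Classical NumberField Pointwise

namespace Summit.BirchSwinnertonDyer.BirchSwinnertonDyer.Cruxes.EulerHalvesAtThree.Birth

open WeierstrassCurve IsDedekindDomain NumberField Field Literature.NumberTheory.EllipticCurves
  Literature.NumberTheory.EllipticCurves.ModularForms Literature.NumberTheory.EllipticCurves.Jetchev2008
  Literature.NumberTheory.EllipticCurves.KolyvaginCocycle
  Literature.NumberTheory.EllipticCurves.Rank1Residual Literature.NumberTheory.GaloisRepresentations
  Literature.NumberTheory.GaloisRepresentations.DiscreteGaloisModule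
  Literature.NumberTheory.GaloisCohomology Literature.NumberTheory.Automorphic
  Summit.BirchSwinnertonDyer.Rank1Residual Summit.BirchSwinnertonDyer.Rank1Residual.X11b
  Summit.BirchSwinnertonDyer.Rank1Residual.X11b.Three Summit.BirchSwinnertonDyer.Rank1Residual.X11b.Three.Koly
  Summit.BirchSwinnertonDyer.Rank1Residual.JET

/-- **STUB (CITABLE — two cite-only Literature FACTS)**: the NAMED inputs of the supply theorem
`Koly.selmerSupplyAtThree_of_poitouTate_Gross1991` (p545834): `hPT` (Poitou–Tate duality for Selmer structures with a
conjugation-compatible family = the tree's named fact `poitouTate_selmerStructure_duality_conj` for every number field; Milne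
ADT I 4.10 + Howard 2.1.11 + Neukirch III §6) and `hF1` (Gross 1991 §6, proof of Prop. 6.2 (1), from [GZ86 III (3.1)]: at
square-free Kolyvagin conductors the Heegner point `y_n` lies in `E⁰` at every place over `N` UP TO A RATIONAL TORSION POINT =
the tree's named fact `Gross1991_heegnerPoint_sub_ratTorsion_mem_E0`, BY NAME — RULING 28's preferred form). v7's conjunct 2,
the unguarded receptacle schema (stub-false as typed: witness 11a1 ∕ ℚ(√−7) ∕ p = 5 ∕ m = 1, mult-p3 g2), is gone.
[cite: MilneADT2006, Ch. I, Thm. 4.10(b)] [cite: Howard2004HeegnerKolyvagin, Thm. 2.1.11]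
[cite: GrossLMS1991, §6 proof of Prop. 6.2 (1) (p. 245)] [cite: GrossZagier1986, III (3.1)] -/
theorem stub_localFactsAtThree :
    (∀ (K : Type) [Field K] [NumberField K], poitouTate_selmerStructure_duality_conj K) ∧
    Gross1991_heegnerPoint_sub_ratTorsion_mem_E0 := by
  sorry

/-- **STUB (CITABLE, by Literature decl name)**: the print facts feeding the display and the composition that are NOT proved
in the tree — McCallum 1991 Prop. 5.2 and Prop. 4.4 (typed named facts), Gross–Zagier I (6.3), modularity (both also conjuncts
of `PublishedInputsThree`; kept here so that the DERIVED `stub_jetchevMaxHLAtThree` is a closed term), McCallum Cor. 5.6.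
v7's `h53` (Gross Prop. 5.3), `hD36` (Darmon 3.6) and `hrec` (Gross §4) are THEOREMS of the tree and are gone.
[cite: McCallumLMS1991, §4 Prop. 4.4, §5 Prop. 5.2, Cor. 5.6] [cite: GrossZagier1986, Thm. I.(6.3)] [cite: BCDTJAMS2001, Thm. A] -/
theorem stub_factsAtThree :
    McCallum1991.prop52_exists_conductor_kolyvaginClass_order_eq ∧
    McCallum1991.prop44_localOrder_kolyvaginClass_mul_eq ∧
    (∀ (N : ℕ) [NeZero N] (W : WeierstrassCurve ℚ) (K : Type) [Field K] [NumberField K],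
      gross_zagier N W K) ∧
    hasEntireLFunction_rat ∧
    McCallum1991_padicValNat_card_sha_primary_add_le_of_globalDivisibility := by
  sorry

/-- **The registered stub `stub_jetchevMaxHLAtThree` (Jetchev Thm. 1.4, MAX form, at `3 ∥ N`), CLOSED MODULO the two CITABLE stubs
`stub_factsAtThree` + `stub_localFactsAtThree`** (six named Literature facts in all) by the tree's display
`Koly.jetchevMaxHLAtThree_of_facts_of_print` (seat g8, p547155). [cite: Jetchev2008, Thm. 1.4 (p. 812), Proof of Thm. 1.4 (p. 825)] -/
theorem stub_jetchevMaxHLAtThree :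
    ∀ (W : WeierstrassCurve ℚ) [W.IsElliptic] [W.IsGloballyMinimal] [NeZero (W.conductorNorm ℤ)]
      (K : Type) [Field K] [NumberField K]
      (Dt : ModularParametrizationData W (W.conductorNorm ℤ)) (β : ℤ) (ι : K →+* ℂ),
      W.analyticRank = 1 → W.HasMultiplicativeReductionAtPrime 3 → Surj W 3 →
      IsImaginaryQuadratic K → SatisfiesHeegnerHypothesis (W.conductorNorm ℤ) K →
      Odd (NumberField.discr K) → (W.quadraticTwist (NumberField.discr K : ℚ)).entireLFunction 1 ≠ 0 →
      (4 * (W.conductorNorm ℤ : ℤ)) ∣ β ^ 2 - NumberField.discr K → ¬ (3 : ℤ) ∣ Dt.c →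
      ∀ (v : HeightOneSpectrum (𝓞 ℚ)) (s : ℕ), s ≤ padicValNat 3 (W.tamagawaNumberAt v) →
        ∀ (n : ℕ) (d : KolyvaginHeegnerData Dt β ι n), Squarefree n →
          (∀ ℓ ∈ n.primeFactors, Zhang2014.IsKolyvaginPrime (W.conductorNorm ℤ) W K 3 ℓ ∧
            s ≤ Zhang2014.kolyvaginIndex W 3 ℓ) → PDiv d 3 s :=
  jetchevMaxHLAtThree_of_facts_of_print stub_factsAtThree.1 stub_factsAtThree.2.1
    stub_factsAtThree.2.2.1 stub_factsAtThree.2.2.2.1 stub_localFactsAtThree.1 stub_localFactsAtThree.2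

/-- STUB (OPEN, IMC-grade): J₃ʳ♭ on MULTI-CARRIER curves (v1 verbatim). [cite: Jetchev2008, Conj. 1.3 (p. 812)] -/
theorem stub_jetchevDivisibilityRamHLMultiAtThree :
    ∀ (W : WeierstrassCurve ℚ) [W.IsElliptic] [W.IsGloballyMinimal] [NeZero (W.conductorNorm ℤ)]
      (K : Type) [Field K] [NumberField K]
      (Dt : ModularParametrizationData W (W.conductorNorm ℤ)) (β : ℤ) (ι : K →+* ℂ),
      W.analyticRank = 1 → W.HasMultiplicativeReductionAtPrime 3 → Surj W 3 → Ram W 3 →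
      (∀ v : HeightOneSpectrum (𝓞 ℚ),
        padicValNat 3 (W.tamagawaNumberAt v) < padicValNat 3 W.tamagawaProduct) →
      IsImaginaryQuadratic K → SatisfiesHeegnerHypothesis (W.conductorNorm ℤ) K →
      Odd (NumberField.discr K) → (W.quadraticTwist (NumberField.discr K : ℚ)).entireLFunction 1 ≠ 0 →
      (4 * (W.conductorNorm ℤ : ℤ)) ∣ β ^ 2 - NumberField.discr K → ¬ (3 : ℤ) ∣ Dt.c →
      ∀ (s : ℕ), s ≤ padicValNat 3 W.tamagawaProduct →
        ∀ (n : ℕ) (d : KolyvaginHeegnerData Dt β ι n), Squarefree n →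
          (∀ ℓ ∈ n.primeFactors, Zhang2014.IsKolyvaginPrime (W.conductorNorm ℤ) W K 3 ℓ ∧
            s ≤ Zhang2014.kolyvaginIndex W 3 ℓ) → PDiv d 3 s := by
  sorry

/-- STUB (OPEN, IMC-grade): J₃⁰♭ on MULTI-CARRIER curves (v1 verbatim). [cite: Jetchev2008, Conj. 1.3 (p. 812)] -/
theorem stub_jetchevDivisibilityNotRamHLMultiAtThree :
    ∀ (W : WeierstrassCurve ℚ) [W.IsElliptic] [W.IsGloballyMinimal] [NeZero (W.conductorNorm ℤ)]
      (K : Type) [Field K] [NumberField K]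
      (Dt : ModularParametrizationData W (W.conductorNorm ℤ)) (β : ℤ) (ι : K →+* ℂ),
      W.analyticRank = 1 → W.HasMultiplicativeReductionAtPrime 3 → Surj W 3 → ¬ Ram W 3 →
      (∀ v : HeightOneSpectrum (𝓞 ℚ),
        padicValNat 3 (W.tamagawaNumberAt v) < padicValNat 3 W.tamagawaProduct) →
      IsImaginaryQuadratic K → SatisfiesHeegnerHypothesis (W.conductorNorm ℤ) K →
      Odd (NumberField.discr K) → (W.quadraticTwist (NumberField.discr K : ℚ)).entireLFunction 1 ≠ 0 →
      (4 * (W.conductorNorm ℤ : ℤ)) ∣ β ^ 2 - NumberField.discr K → ¬ (3 : ℤ) ∣ Dt.c →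
      ∀ (s : ℕ), s ≤ padicValNat 3 W.tamagawaProduct →
        ∀ (n : ℕ) (d : KolyvaginHeegnerData Dt β ι n), Squarefree n →
          (∀ ℓ ∈ n.primeFactors, Zhang2014.IsKolyvaginPrime (W.conductorNorm ℤ) W K 3 ℓ ∧
            s ≤ Zhang2014.kolyvaginIndex W 3 ℓ) → PDiv d 3 s := by
  sorry

/-- STUB (OPEN — v4 ∕ v7, RULING 22 (B)): the X11a LOWER HALF AT 3 = item 19064 `MissingLowerBoundAtThreeX11a`'s
statement READ AT `p = 3` only (`ClassX11a V 3` = analytic rank 0 ∧ 3 ≠ 2 ∧ Mult ∧ Irr ∧ ¬Ram at 3 →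
`Typed.MissingLowerBoundAt V 3`, the main-conjecture-direction half of BSD(V, 3)). mult-p3 g0 (p526914 ∕ p527466 ∕
p533905's sibling `…TwistLowerOfX11a.lean`) showed TL₃ ⟺ this on the tree's published record; it is the genuine open
object behind TL₃ (the (ram) sub-case of TL₃ is Skinner 2016 Thm C with equality, published). [cite: Skinner2016PacificMC,
Thm. C (§1)] [cite: SkinnerUrban2014, Thm. 3.29 ∕ §3.6 — the multiplicative unramified case is NOT covered there: open] -/
theorem stub_x11aLowerHalfAtThree :
    ∀ (V : WeierstrassCurve ℚ) [V.IsElliptic] [V.IsGloballyMinimal],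
      Summit.BirchSwinnertonDyer.Rank1Residual.ClassX11a V 3 →
        Literature.NumberTheory.EllipticCurves.Rank1Residual.Typed.MissingLowerBoundAt V 3 := by
  sorry

/-- TL₃ (v1 ∕ v3's `stub_twistLowerAtThree`, statement VERBATIM) — **v4 ∕ v7: NO LONGER A STUB**: derived from
`stub_x11aLowerHalfAtThree` and three conjuncts of `PublishedInputsThree` (modularity, GZK, Skinner 2016 Thm C) by
mult-p3 g0's `Koly.twistLowerAtThree_of_thmC_of_x11aLowerHalfAtThree` (`Theorems/ClassRecordThreeEulerHalvesAtThreeTwistLowerOfX11a.lean`). -/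
theorem twistLowerAtThree_of_x11aLowerHalf (hmod : hasEntireLFunction_rat)
    (hGZK : rank_eq_analyticRank_of_analyticRank_le_one)
    (hSk : Skinner2016.thmC_padicValRat_bsd_rank_zero) :
    ∀ (V : WeierstrassCurve ℚ) [V.IsElliptic] [V.IsGloballyMinimal],
      V.HasMultiplicativeReductionAtPrime 3 → V.HasIrreducibleModPGaloisRep 3 →
      V.entireLFunction 1 ≠ 0 → Finite V.sha →
      ∃ q : ℚ, V.entireLFunction 1 / (V.realPeriodRat : ℂ) = (q : ℂ) ∧
        padicValRat 3 q ≤ (padicValNat 3 V.shaOrder : ℤ) + padicValNat 3 V.tamagawaProduct -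
          2 * padicValNat 3 V.torsionOrder :=
  Summit.BirchSwinnertonDyer.Rank1Residual.X11b.Three.Koly.twistLowerAtThree_of_thmC_of_x11aLowerHalfAtThree
    hmod hGZK hSk stub_x11aLowerHalfAtThree

/-- **Composition**: the crux BY NAME from `PublishedInputsThree` (item 19112, by name) and the stubs,
through `…JetchevMax.lean` §3; `hrec`/`hD36` are the Literature theorems. -/
theorem EulerHalvesAtThree_of
    (h : Summit.BirchSwinnertonDyer.BirchSwinnertonDyer.Theses.ClassRecordThree.PublishedInputsThree) :
    Summit.BirchSwinnertonDyer.BirchSwinnertonDyer.Theses.ClassRecordThree.EulerHalvesAtThree := by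
  obtain ⟨hGZ, hKo, -, hSk, -, hGZK, hmod, hnf, hHL, hMaz, -, -, -, -, -, -, -, -, -, -⟩ := h
  obtain ⟨-, -, -, -, hMcU⟩ := stub_factsAtThree
  exact classRecordThree_eulerHalvesAtThree_of_jetchevMaxHL_of_multi_of_twistLower hGZ hKo hSk hGZK hmod
    hnf hHL hMaz (fun N _ W K _ _ ↦ heegnerPointOfConductor_one_galoisConj_holds N W K)
    (fun N _ W K _ _ ↦ phi_heegnerTau_mem_singularModuliField_holds N W K) hMcU stub_jetchevMaxHLAtThree
    stub_jetchevDivisibilityRamHLMultiAtThree stub_jetchevDivisibilityNotRamHLMultiAtThree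
    (twistLowerAtThree_of_x11aLowerHalf hmod hGZK hSk)

/-- **The `KolyvaginRoadThree` twin** (same statement). -/
theorem EulerHalvesAtThree_of'
    (h : Summit.BirchSwinnertonDyer.BirchSwinnertonDyer.Theses.ClassRecordThree.PublishedInputsThree) :
    Summit.BirchSwinnertonDyer.BirchSwinnertonDyer.Theses.KolyvaginRoadThree.EulerHalvesAtThree := by
  obtain ⟨hGZ, hKo, -, hSk, -, hGZK, hmod, hnf, hHL, hMaz, -, -, -, -, -, -, -, -, -, -⟩ := h
  obtain ⟨-, -, -, -, hMcU⟩ := stub_factsAtThree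
  exact kolyvaginRoadThree_eulerHalvesAtThree_of_jetchevMaxHL_of_multi_of_twistLower hGZ hKo hSk hGZK hmod
    hnf hHL hMaz (fun N _ W K _ _ ↦ heegnerPointOfConductor_one_galoisConj_holds N W K)
    (fun N _ W K _ _ ↦ phi_heegnerTau_mem_singularModuliField_holds N W K) hMcU stub_jetchevMaxHLAtThree
    stub_jetchevDivisibilityRamHLMultiAtThree stub_jetchevDivisibilityNotRamHLMultiAtThree
    (twistLowerAtThree_of_x11aLowerHalf hmod hGZK hSk)

end Summit.BirchSwinnertonDyer.BirchSwinnertonDyer.Cruxes.EulerHalvesAtThree.Birth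

end
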